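import Mathlib
import Literature.Analysis.FluidPDE.Tao2016AveragedNS.ShiftSetCascadeFlows
import Summits.NavierStokesRegularity.NavierStokesRegularity.Theorems.TaoLadderRungTwoFlatMirrorTableDefs
import HarnessLib

/-!
# Tao ladder, rung 2♭ — the ENERGY-FLUX IDENTITY of the mirror table (LADDER §48)

Tree-ready module (tree name `…Theorems.TaoLadderRungTwoFlatEnergyFluxPointwise` (theory-1 proposed `…EnergyFlux`, which p1 g20 had already used for the shell-flux identity via `botSumOn`); cell copy
`harvest-h2-tao-ladder-theory-1/numT48/EnergyFlux48.lean`, theory-1 g36; to be landed by a prover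
`--supports stmt-NavierStokesRegularity-22987 --as helper`).

For the graded mirror lattice `Ẋ = quadTermOn S♭ ε₀ (mirrorTable ε ε) X` (clock `c_n = (1+ε₀)^{5n/2}`,
species `0 = a` carrier, `1 = v` bond) the quadratic form satisfies, pointwise in time and WITHOUT any ODE,
  `a_n · Q_a,n = T_{n−1} − S_n`,   `v_n · Q_v,n = S_n − T_n`,   hence   `a_n·Q_a,n + v_n·Q_v,n = T_{n−1} − T_n`,
with the cut fluxes `T_n := c_n · v_n · a_{n+1} · (v_n + ε·a_{n+1})` (between shells `n | n+1`) and
`S_n := c_n · a_n · v_n · (v_n + ε·a_n)` (between `a_n | v_n`). Along a solution this is the per-site energy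
balance `ė_n = T_{n−1} − T_n`, `e_n = ½(a_n² + v_n²)`: the lattice is a conservative nearest-neighbour chain
whose fluxes are CUBIC with `|flux| ≤ c·(1+ε)·sup|X|·|x_p|·|x_{p+1}|`. Consequence used by the two-layer split
of K_A♭ (LADDER §48.2, desk): an exponentially weighted energy grows at rate `≤ 4 sinh(θ'/2)(1+ε)cA`, so every
energy front moves at most `(1+ε)·A·c·sinh(θ/4)/(θ/4)` shells per unit time (`A` = sup amplitude) — the
junk-vs-front race behind the captured pulse (interface constant `MirrorPulse.junkThreshold`).

HONEST FRAMING: three algebraic identities about a MODEL lattice (Tao 2016 §4 vocabulary on `S♭`), kernel-checked;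
nothing certified about any orbit; nothing about the Navier–Stokes equations.
-/

-- the sub-problem namespace repeats the summit name by design (D-0017)
set_option linter.dupNamespace false

noncomputable section

namespace Summit.NavierStokesRegularity.NavierStokesRegularity.Theorems

open Literature.Analysis.FluidPDE Literature.Analysis.FluidPDE.TaoCascade

namespace MirrorPulse

/-- The CLOCK of shell `n` at grading `ε₀`: `(1+ε₀)^{5n/2}` (the factor `quadTermOn` attaches to a triad based
at shell `n`). [cite: Tao2016AveragedNS, §4 (4.1) (the `(1+ε₀)^{5n/2}` scaling); route TaoLadderRungTwoFlat] -/
def clock (ε₀ : ℝ) (n : ℤ) : ℝ := (1 + ε₀) ^ ((5 : ℝ) * n / 2)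

/-- The ENERGY FLUX across the cut between shells `n` and `n+1` (from `{≤ n}` into `{≥ n+1}`) of the mirror
lattice `T♭(ε)` at time `t`: `T_n = c_n · v_n · a_{n+1} · (v_n + ε·a_{n+1})`.
[cite: Tao2016AveragedNS, §4 (4.3) (cancellation ⇒ local conservation form); route TaoLadderRungTwoFlat, posited object] -/
def fluxT (ε ε₀ : ℝ) (X : Fin 2 → ℤ → ℝ → ℝ) (n : ℤ) (t : ℝ) : ℝ :=
  clock ε₀ n * X 1 n t * X 0 (n + 1) t * (X 1 n t + ε * X 0 (n + 1) t)

/-- The ENERGY FLUX across the half-cut between the carrier `a_n` and the bond `v_n` at time `t`: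
`S_n = c_n · a_n · v_n · (v_n + ε·a_n)`. [cite: Tao2016AveragedNS, §4 (4.3); route TaoLadderRungTwoFlat, posited object] -/
def fluxS (ε ε₀ : ℝ) (X : Fin 2 → ℤ → ℝ → ℝ) (n : ℤ) (t : ℝ) : ℝ :=
  clock ε₀ n * X 0 n t * X 1 n t * (X 1 n t + ε * X 0 n t)

/-- **FLUX IDENTITY, carrier half**: `a_n · Q(X)_{a,n} = T_{n−1} − S_n` for the graded mirror table, every
`ε, ε₀, X, n, t` (pure algebra over the 28-term sum). [cite: Tao2016AveragedNS, §4 (4.1)–(4.3); route TaoLadderRungTwoFlat, λ₀ = 1 layer / transfer (L8)] -/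
theorem carrier_mul_quadTermOn (ε ε₀ : ℝ) (X : Fin 2 → ℤ → ℝ → ℝ) (n : ℤ) (t : ℝ) :
    X 0 n t * quadTermOn shiftSetFlat ε₀ (mirrorTable ε ε) X 0 n t
      = fluxT ε ε₀ X (n - 1) t - fluxS ε ε₀ X n t := by
  simp only [quadTermOn, fluxS, fluxT, clock, shiftSetFlat, mirrorTable, Fin.sum_univ_two, Fin.isValue]
  norm_num
  ring_nf

/-- **FLUX IDENTITY, bond half**: `v_n · Q(X)_{v,n} = S_n − T_n`.
[cite: Tao2016AveragedNS, §4 (4.1)–(4.3); route TaoLadderRungTwoFlat, λ₀ = 1 layer / transfer (L8)] -/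
theorem bond_mul_quadTermOn (ε ε₀ : ℝ) (X : Fin 2 → ℤ → ℝ → ℝ) (n : ℤ) (t : ℝ) :
    X 1 n t * quadTermOn shiftSetFlat ε₀ (mirrorTable ε ε) X 1 n t
      = fluxS ε ε₀ X n t - fluxT ε ε₀ X n t := by
  simp only [quadTermOn, fluxS, fluxT, clock, shiftSetFlat, mirrorTable, Fin.sum_univ_two, Fin.isValue]
  norm_num
  ring_nf

/-- **PER-SITE ENERGY-FLUX IDENTITY**: `a_n·Q_a,n + v_n·Q_v,n = T_{n−1} − T_n`; along any solution of the graded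
mirror lattice this is `d/dt ½(a_n² + v_n²) = T_{n−1} − T_n` (local conservation of the energy `½Σ(a²+v²)`).
[cite: Tao2016AveragedNS, §4 (4.3); route TaoLadderRungTwoFlat, λ₀ = 1 layer / transfer (L8)] -/
theorem site_energy_flux (ε ε₀ : ℝ) (X : Fin 2 → ℤ → ℝ → ℝ) (n : ℤ) (t : ℝ) :
    X 0 n t * quadTermOn shiftSetFlat ε₀ (mirrorTable ε ε) X 0 n t
      + X 1 n t * quadTermOn shiftSetFlat ε₀ (mirrorTable ε ε) X 1 n t
      = fluxT ε ε₀ X (n - 1) t - fluxT ε ε₀ X n t := by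
  rw [carrier_mul_quadTermOn, bond_mul_quadTermOn]; ring

/-- The flux is CUBIC with one factor from each side of the cut: `|T_n| ≤ c_n·(1+ε)·A·|v_n|·|a_{n+1}|` whenever
`|v_n|, |a_{n+1}| ≤ A` and `0 ≤ ε` (the pointwise input of the weighted-energy speed bound).
[cite: Tao2016AveragedNS, §4 (4.3); route TaoLadderRungTwoFlat, transfer (L8b)] -/
theorem abs_fluxT_le {ε ε₀ A : ℝ} (hε : 0 ≤ ε) (hε₀ : -1 ≤ ε₀) (X : Fin 2 → ℤ → ℝ → ℝ) (n : ℤ) (t : ℝ)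
    (hv : |X 1 n t| ≤ A) (ha : |X 0 (n + 1) t| ≤ A) :
    |fluxT ε ε₀ X n t| ≤ clock ε₀ n * ((1 + ε) * A) * (|X 1 n t| * |X 0 (n + 1) t|) := by
  have hc : 0 ≤ clock ε₀ n := by
    unfold clock; exact Real.rpow_nonneg (by linarith) _
  have hA : 0 ≤ A := (abs_nonneg _).trans hv
  have h3 : |X 1 n t + ε * X 0 (n + 1) t| ≤ (1 + ε) * A := by
    calc |X 1 n t + ε * X 0 (n + 1) t| ≤ |X 1 n t| + |ε * X 0 (n + 1) t| := abs_add_le _ _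
      _ = |X 1 n t| + ε * |X 0 (n + 1) t| := by rw [abs_mul, abs_of_nonneg hε]
      _ ≤ A + ε * A := by gcongr
      _ = (1 + ε) * A := by ring
  unfold fluxT
  rw [abs_mul, abs_mul, abs_mul, abs_of_nonneg hc]
  have h12 : 0 ≤ |X 1 n t| * |X 0 (n + 1) t| := by positivity
  calc clock ε₀ n * |X 1 n t| * |X 0 (n + 1) t| * |X 1 n t + ε * X 0 (n + 1) t|
      = clock ε₀ n * (|X 1 n t| * |X 0 (n + 1) t|) * |X 1 n t + ε * X 0 (n + 1) t| := by ring
    _ ≤ clock ε₀ n * (|X 1 n t| * |X 0 (n + 1) t|) * ((1 + ε) * A) := by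
        exact mul_le_mul_of_nonneg_left h3 (mul_nonneg hc h12)
    _ = clock ε₀ n * ((1 + ε) * A) * (|X 1 n t| * |X 0 (n + 1) t|) := by ring

end MirrorPulse

end Summit.NavierStokesRegularity.NavierStokesRegularity.Theorems

end
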